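import Summits.ABC.IUTFork.Conditional.Layer3OfSNegative
import Summits.ABC.IUTFork.Conditional.Layer3OfSResidualRefuted
import Literature.AnabelianGeometry.SemiGraphs.ThetaRayRefutation
import Literature.AnabelianGeometry.SemiGraphs.ThetaRayRefutationMaximalCompact

/-!
# L3 LAYER CERTIFICATE — BOTH L3 residual binders are REFUTED at universe 0; the finite-graph reading is what survives

abc-iut cell, branch C «CONDITIONAL VERIFICATION abc ⇐ S» (rung LADDER-ABC:A2.C); PROOF-ONLY sequel (no `def`, no new `Prop`) to
`Conditional/Layer3OfS.lean` (CERT-L3, abc-iut-w6-d045), `Conditional/Layer3OfSNegative.lean` (the ¬-bridges in binder form) and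
`Conditional/Layer3OfSResidualRefuted.lean` (abc-iut-w4-d011, p441107: the LITERAL residual via `Cor39`).  This file performs the «one-line
instantiation» the bridges were written for, now that the refutations have LANDED (2026-08-26, REFUTE-F1732 programme R7):

* `ProfiniteSemiGraph.not_compactInVerticial : ¬ CompactInVerticial.{0}` (abc-iut-L3-d4, p442260, `ThetaRayRefutation.lean` — FACT-LIST F-1732,
  the ∀-COUNTABLE typing of [SemiAnbd] Thm 3.7 (iii); countermodel the theta ray `𝒢_θ(2, k ↦ k+1)` with an escaping compact subgroup);
* `ProfiniteSemiGraph.not_maximalCompactIffVerticial : ¬ MaximalCompactIffVerticial.{0}` (abc-iut-w6-d120, p443103 — F-1750, Thm 3.7 (iv)).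

CERTIFIED HERE (kernel, by name):
* `not_layer3ResidualOfRecord` — the L3 binder OF RECORD `Layer3ResidualOfRecord.{0}` (CompactInVerticial ∧ MaximalCompactIffVerticial ∧
  Cor39CompatUpToTwist; L3-lead rulings χ2/ξ2) is UNSATISFIABLE at `u₁ = 0`; `layer3ResidualOfRecord_iff_false` the one-name form;
* `not_layer3ConeOfRecord` — hence `¬ (Layer3Discharged ∧ Layer3ResidualOfRecord)` at universe 0;
* `layer3Residual_false_three_ways` — the LITERAL residual is refuted through EACH of its three conjuncts (F-1732, F-1750, F-1710);
* `layer3_scoreboard_zero` — the L3 row of the C scoreboard in ONE conjunction at universe 0: discharged half PROVED ∧ finite-semi-graph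
  residual PROVED ∧ literal ∀-countable residual REFUTED ∧ ∀-countable residual of record REFUTED.

K-HAZARD READING: every theorem binding `(h : Layer3ResidualOfRecord.{0})`, `(h : Layer3Residual.{0})` or `(h : CompactInVerticial.{0})`
(F-COVERAGE: 71 consumers of the latter, e.g. `layer3ConeOfRecord_of_compactInVerticial`, `cor39CompatUpToTwist_of_compactInVerticial`) is
VACUOUSLY conditional at universe 0; consumers should bind the per-graph `CompactInVerticialAt 𝒢`, a THEOREM at every finite `𝒢`
(`compactInVerticialAt_of_finiteGraph`, abc-iut-L3-t8 p431007).  No apex certificate `abc_of_S*` imports `Layer3OfS` (tree scan 12:2xZ).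

HONEST FRAMING: what is refuted are OUR ∀-countable typings of [SemiAnbd] Thm 3.7 (iii)/(iv) and our literal typing of Def. 3.8 inside
`Cor39` — print proves the statements for (finite) semi-graphs of anabelioids and IUT instantiates finite dual semi-graphs ([IUTchI] Rmk 2.5.3);
those finite statements are kernel theorems (`layer3ResidualFinite_holds`).  Nothing here asserts that abc is proved or refuted or takes a side
on [IUTchIII] Cor. 3.12; a refuted binder makes a conditional theorem vacuous, not wrong; typed ≠ proved.
[claim: Mochizuki2012, status: disputed] [cite: MochizukiSemiAnbd2006, Thm 3.7 (iii)(iv) pp.40–41, Cor 3.9 p.42]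
-/

namespace Summit.ABC.IUTFork.Conditional

open Literature.AnabelianGeometry.SemiGraphs

universe u₂ u₃ u₄ u₅

/-- **The L3 binder OF RECORD is unsatisfiable at universe 0**: `Layer3ResidualOfRecord.{0}` has `CompactInVerticial.{0}` as its first
conjunct, refuted by abc-iut-L3-d4's `ProfiniteSemiGraph.not_compactInVerticial` (p442260). One-line instantiation of the landed bridge
`layer3ResidualOfRecord_false_of_not_compactInVerticial`. [claim: Mochizuki2012, status: disputed] -/
theorem not_layer3ResidualOfRecord : ¬ Layer3ResidualOfRecord.{0} :=
  layer3ResidualOfRecord_false_of_not_compactInVerticial ProfiniteSemiGraph.not_compactInVerticial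

/-- One-name form for hypothesis audits: at universe 0 the residual of record is equivalent to `False`.
[claim: Mochizuki2012, status: disputed] -/
theorem layer3ResidualOfRecord_iff_false : Layer3ResidualOfRecord.{0} ↔ False :=
  ⟨not_layer3ResidualOfRecord, False.elim⟩

/-- Hence the «cone of record» conjunction `Layer3Discharged ∧ Layer3ResidualOfRecord` (the target of `layer3ConeOfRecord_of_compactInVerticial`)
is unsatisfiable at `u₁ = 0`. [claim: Mochizuki2012, status: disputed] -/
theorem not_layer3ConeOfRecord : ¬ (Layer3Discharged.{0, u₂, u₃, u₄, u₅} ∧ Layer3ResidualOfRecord.{0}) :=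
  fun h => not_layer3ResidualOfRecord h.2

/-- **The LITERAL residual is refuted through each of its three conjuncts** — F-1732 (`not_compactInVerticial`), F-1750
(`not_maximalCompactIffVerticial`, abc-iut-w6-d120 p443103) and F-1710 (`IwahoriWitness.not_cor39`, abc-iut-f-175 p439444, via p441107) — recorded
as one conjunction of the three landed routes. [claim: Mochizuki2012, status: disputed] -/
theorem layer3Residual_false_three_ways :
    (¬ ProfiniteSemiGraph.CompactInVerticial.{0} ∧ ¬ ProfiniteSemiGraph.MaximalCompactIffVerticial.{0} ∧ ¬ ProfiniteSemiGraph.Cor39.{0})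
      ∧ ¬ Layer3Residual.{0} :=
  ⟨⟨ProfiniteSemiGraph.not_compactInVerticial, ProfiniteSemiGraph.not_maximalCompactIffVerticial, IwahoriWitness.not_cor39⟩,
    layer3Residual_false_of_not_maximalCompactIffVerticial ProfiniteSemiGraph.not_maximalCompactIffVerticial⟩

/-- **The L3 row of the C scoreboard at universe 0, in one conjunction (all four members kernel facts):** the discharged half holds
(`layer3Discharged_holds`), the FINITE-semi-graph residual holds outright (`layer3ResidualFinite_holds`), the literal ∀-countable residual is
refuted, and the ∀-countable residual OF RECORD is refuted. Reading: «L3's honest residual for the Cor 3.12 cone is EMPTY at finite dual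
semi-graphs and its ∀-countable binders are false as typed». [claim: Mochizuki2012, status: disputed] -/
theorem layer3_scoreboard_zero :
    Layer3Discharged.{0, u₂, u₃, u₄, u₅} ∧ Layer3ResidualFinite.{0} ∧ ¬ Layer3Residual.{0} ∧ ¬ Layer3ResidualOfRecord.{0} :=
  ⟨layer3Discharged_holds, layer3ResidualFinite_holds, not_layer3Residual, not_layer3ResidualOfRecord⟩

end Summit.ABC.IUTFork.Conditional
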